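import Summits.MatrixMultiplication.MatrixMultiplication.Theorems.LevelOneGL2Designs.Negative.LevelSpace
import Summits.MatrixMultiplication.MatrixMultiplication.Theorems.LevelTwoBeatsCubes.Negative.GradedNeumannCount

/-!
# Negative lemmas for the crux `LevelOneGL2Designs` (stmt-MatrixMultiplication-14080), part C:
the graded Neumann count at `(2,1)` and the constant window `c ≤ 1/√2`

Refuter-side (cdisprove) analysis; no theorem asserts a Theses statement positively.
* `neumann_X_levelOne`, `neumann_Z_levelOne` — `|X||Z| + |X|(|Y|−1) ≤ N₁(p) = p³ + p² − p` for every
  rank-1-separated triple of `GL_2(𝔽_p)` (the sibling route's `GradedNeumannCount.packing_X/Z`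
  applied to the bi-invariant submodule `F_1|_G` of part L, plus the exact count of part A).
* `not_levelOneGL2Designs_const` — STRENGTHENING REFUTED: for every `c > 1/√2` the constant-`c`
  slice of the crux is FALSE (`2c²p³ − cp^{3/2} ≤ p³ + p²` fails for large `p`).
* `levelOneGL2Designs_iff_small` — hence the crux is equivalent to its restriction to constants
  `c ∈ (0, 1/√2]`: the graded Neumann count is exactly tight at the crux's scale and says no more.
-/

noncomputable section

namespace Summit.MatrixMultiplication.MatrixMultiplication.Theorems.LevelOneGL2Designs.Negative

open Summit.MatrixMultiplication.MatrixMultiplication.Theses.LevelGradedCohnUmans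
open Summit.MatrixMultiplication.MatrixMultiplication.Theorems.LieRankDesigns.Negative

variable {p : ℕ}

section Neumann21

variable [Fact p.Prime] {X Y Z : Finset (GLm p 2)}

/-- `N₁(p) ≤ p³ + p²` (crude form of part A's exact count). -/
theorem card_rankLE_two_one_le : Fintype.card {M : Mat p 2 // M.rank ≤ 1} ≤ p ^ 3 + p ^ 2 := by
  rw [card_rankLE_two_one]; exact Nat.sub_le _ _

/-- **Graded Neumann count at level one, `X`-slab**: `|X||Z| + |X|(|Y| − 1) ≤ p³ + p² − p`. -/
theorem neumann_X_levelOne (hsep : RankSep 1 X Y Z) {y₁ z₁ : GLm p 2} (hy₁ : y₁ ∈ Y)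
    (hz₁ : z₁ ∈ Z) : X.card * Z.card + X.card * (Y.card - 1) ≤ p ^ 3 + p ^ 2 - p := by
  rw [← card_rankLE_two_one]
  exact (Summit.MatrixMultiplication.MatrixMultiplication.Theorems.LevelTwoBeatsCubes.Negative.packing_X
    (levelSubmodule p 2 1) levelSubmodule_right_inv X Y Z (sep_clause_of_rankSep hsep) hy₁ hz₁).trans
    finrank_levelSubmodule_le

/-- **Graded Neumann count at level one, `Z`-slab**: `|X||Z| + (|Y| − 1)|Z| ≤ p³ + p² − p`. -/
theorem neumann_Z_levelOne (hsep : RankSep 1 X Y Z) {x₁ y₁ : GLm p 2} (hx₁ : x₁ ∈ X)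
    (hy₁ : y₁ ∈ Y) : X.card * Z.card + (Y.card - 1) * Z.card ≤ p ^ 3 + p ^ 2 - p := by
  rw [← card_rankLE_two_one]
  exact (Summit.MatrixMultiplication.MatrixMultiplication.Theorems.LevelTwoBeatsCubes.Negative.packing_Z
    (levelSubmodule p 2 1) levelSubmodule_left_inv X Y Z (sep_clause_of_rankSep hsep) hx₁ hy₁).trans
    finrank_levelSubmodule_le

end Neumann21

/-! ## STRENGTHENING REFUTED: the constant window is `c ≤ 1/√2` (graded Neumann is tight here) -/

/-- **No constant above `1/√2` (squared form).**  For `2c² > 1` the constant-`c` slice of the crux is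
FALSE: graded Neumann gives `|X||Z| + |X|(|Y|−1) ≤ N₁(p) ≤ p³ + p²`, while the size bounds give
`≥ 2c²p³ − c p^{3/2} ≥ 2c²p³ − cp²`, absurd once `(2c² − 1)p > 1 + c`. -/
theorem not_levelOneGL2Designs_const_of_sq {c : ℝ} (hc : 0 < c) (hc2 : 1 < 2 * c ^ 2) :
    ¬ ∀ p₀ : ℕ, ∃ (p : ℕ) (_ : Fact p.Prime), p₀ ≤ p ∧
        ∃ X Y Z : Finset (GLm p 2), RankSep 1 X Y Z ∧
          c * (p : ℝ) ^ (3 / 2 : ℝ) ≤ X.card ∧ c * (p : ℝ) ^ (3 / 2 : ℝ) ≤ Y.card ∧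
          c * (p : ℝ) ^ (3 / 2 : ℝ) ≤ Z.card := by
  intro hall
  obtain ⟨N, hN⟩ := exists_nat_gt (max (1 / c) ((1 + c) / (2 * c ^ 2 - 1)))
  obtain ⟨p, hprime, hNp, X, Y, Z, hsep, hX, hY, hZ⟩ := hall N
  have hp0 : (0 : ℝ) < p := prime_cast_pos
  have hNR : (N : ℝ) ≤ p := by exact_mod_cast hNp
  have h1c : 1 / c < p := lt_of_lt_of_le (lt_of_le_of_lt (le_max_left _ _) hN) hNR
  have hthr : (1 + c) / (2 * c ^ 2 - 1) < p :=
    lt_of_lt_of_le (lt_of_le_of_lt (le_max_right _ _) hN) hNR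
  set L : ℝ := c * (p : ℝ) ^ (3 / 2 : ℝ) with hL
  have hL1 : 1 ≤ L := by
    have h1 : 1 < c * p := by
      have := (div_lt_iff₀ hc).mp h1c
      linarith [this]
    have h2 : c * p ≤ L := mul_le_mul_of_nonneg_left prime_cast_le_rpow_three_halves hc.le
    linarith
  have hpos : ∀ {S : Finset (GLm p 2)}, L ≤ S.card → S.Nonempty := by
    intro S hS
    rw [← Finset.card_pos]
    have : (0 : ℝ) < S.card := lt_of_lt_of_le (by linarith) hS
    exact_mod_cast this
  obtain ⟨y₁, hy₁⟩ := hpos hY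
  obtain ⟨z₁, hz₁⟩ := hpos hZ
  have hneu : ((X.card * Z.card + X.card * (Y.card - 1) : ℕ) : ℝ) ≤ (p : ℝ) ^ 3 + (p : ℝ) ^ 2 := by
    exact_mod_cast (neumann_X_levelOne hsep hy₁ hz₁).trans (Nat.sub_le _ _)
  have hY1 : 1 ≤ Y.card := Finset.card_pos.mpr ⟨y₁, hy₁⟩
  have hcast : ((X.card * Z.card + X.card * (Y.card - 1) : ℕ) : ℝ)
      = (X.card : ℝ) * Z.card + X.card * ((Y.card : ℝ) - 1) := by
    push_cast [Nat.cast_sub hY1]; ring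
  rw [hcast] at hneu
  have hXZ : L * L ≤ (X.card : ℝ) * Z.card := mul_le_mul hX hZ (by linarith) (le_trans (by linarith) hX)
  have hXY : L * (L - 1) ≤ (X.card : ℝ) * ((Y.card : ℝ) - 1) :=
    mul_le_mul hX (by linarith) (by linarith) (le_trans (by linarith) hX)
  have hLL : L * L = c ^ 2 * (p : ℝ) ^ 3 := by
    rw [hL]; calc c * (p : ℝ) ^ (3 / 2 : ℝ) * (c * (p : ℝ) ^ (3 / 2 : ℝ))
        = c ^ 2 * ((p : ℝ) ^ (3 / 2 : ℝ) * (p : ℝ) ^ (3 / 2 : ℝ)) := by ring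
      _ = c ^ 2 * (p : ℝ) ^ 3 := by rw [rpow_three_halves_mul_self]
  have hLp2 : L ≤ c * (p : ℝ) ^ 2 := mul_le_mul_of_nonneg_left rpow_three_halves_le_sq hc.le
  have hmain : 2 * c ^ 2 * (p : ℝ) ^ 3 - c * (p : ℝ) ^ 2 ≤ (p : ℝ) ^ 3 + (p : ℝ) ^ 2 := by
    nlinarith
  have hden : 0 < 2 * c ^ 2 - 1 := by linarith
  have hthr' : 1 + c < (2 * c ^ 2 - 1) * p := by
    have := (div_lt_iff₀ hden).mp hthr
    linarith
  have hp2 : 0 < (p : ℝ) ^ 2 := by positivity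
  nlinarith [mul_lt_mul_of_pos_right hthr' hp2]

/-- **No constant above `1/√2`.** -/
theorem not_levelOneGL2Designs_const {c : ℝ} (hc : 1 / Real.sqrt 2 < c) :
    ¬ ∀ p₀ : ℕ, ∃ (p : ℕ) (_ : Fact p.Prime), p₀ ≤ p ∧
        ∃ X Y Z : Finset (GLm p 2), RankSep 1 X Y Z ∧
          c * (p : ℝ) ^ (3 / 2 : ℝ) ≤ X.card ∧ c * (p : ℝ) ^ (3 / 2 : ℝ) ≤ Y.card ∧
          c * (p : ℝ) ^ (3 / 2 : ℝ) ≤ Z.card := by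
  have h0 : 0 < 1 / Real.sqrt 2 := by positivity
  have hc0 : 0 < c := lt_trans h0 hc
  refine not_levelOneGL2Designs_const_of_sq hc0 ?_
  have h := mul_self_lt_mul_self h0.le hc
  have h2 : 1 / Real.sqrt 2 * (1 / Real.sqrt 2) = 1 / 2 := by
    rw [div_mul_div_comm, one_mul, Real.mul_self_sqrt (by norm_num)]
  rw [h2] at h
  nlinarith

/-- **The constant window.**  The crux is equivalent to its restriction to constants
`c ∈ (0, 1/√2]`: larger constants are refuted by the graded Neumann count. -/
theorem levelOneGL2Designs_iff_small :
    LevelOneGL2Designs ↔ ∃ c : ℝ, 0 < c ∧ c ≤ 1 / Real.sqrt 2 ∧ ∀ p₀ : ℕ, ∃ (p : ℕ) (_ : Fact p.Prime),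
      p₀ ≤ p ∧ ∃ X Y Z : Finset (GLm p 2), RankSep 1 X Y Z ∧
        c * (p : ℝ) ^ (3 / 2 : ℝ) ≤ X.card ∧ c * (p : ℝ) ^ (3 / 2 : ℝ) ≤ Y.card ∧
        c * (p : ℝ) ^ (3 / 2 : ℝ) ≤ Z.card := by
  rw [levelOneGL2Designs_iff_rankSep]
  constructor
  · rintro ⟨c, hc, h⟩
    by_cases hle : c ≤ 1 / Real.sqrt 2
    · exact ⟨c, hc, hle, h⟩
    · exact absurd h (not_levelOneGL2Designs_const (lt_of_not_ge hle))
  · rintro ⟨c, hc, -, h⟩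
    exact ⟨c, hc, h⟩

end Summit.MatrixMultiplication.MatrixMultiplication.Theorems.LevelOneGL2Designs.Negative

end
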